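import Summits.Ventures.PercRepro.ProfilePointedCircuitClassesStarSharpD0C
import Summits.Ventures.PercRepro.ProfilePointedCircuitClassesStarSharpD0I

/-!
# PercRepro — CASE D0 OF `StarNineSharp`, PART J: THE «NO ON LINE» REGIME IS PROVED
(p5, gen 54; `proofs/P5-GM1.md` §81 (c))

If some rank-`3` subset `Y₀ ⊆ E₇` through `e, f` is ON, its closure `H := {z ∈ E₇ : ρ(Y₀ + z) = 3}` is an ON
rank-`3` flat through `e, f` (`on_plane_of_on_set`), and D0I applies; otherwise every rank-`3` subset through `e, f`
is OFF and D0C applies.  **`inCount_thru_le_of_no_on_line`**: on a coloop-free `N` with `#E = 9`, `ρ = 5`, a series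
pair `{b, b′}` and `e ≠ f` outside it, if `ρ(E₇) = 4`, no line of `E₇` is ON, `e` and `f` are simple on
`X = E₇ − e − f`, `ρ{e, f} = 2` and `ρ(X) = 4`, then `in_4(e) + thru_4({b′,f}) + thru_4({b′,e,f}) ≤
in_4(f) + thru_4({e,f}) + thru_4({b′,e})` — the «no ON line» regime of case D0 of `StarNineSharp`
(139,006 of the 191,842 D0 configurations of the catalogue, among them every planes-only cut).
-/

open scoped Matroid

namespace PercRepro.Cogirth

open Finset ThmH Skew Shadow Profile

variable {α : Type} [DecidableEq α] {N : Matroid α} [N.Finite]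

section StarSharpD0J

variable {b b' : α}

/-- Points adding no rank to `Y` add no rank together: `ρ(Y ∪ S) = ρ(Y)` (induction on `S`). -/
theorem rk_union_eq_of_forall_insert_eq {Y : Finset α} (S : Finset α)
    (hS : ∀ z ∈ S, rk N (insert z Y) = rk N Y) : rk N (Y ∪ S) = rk N Y := by
  induction S using Finset.induction_on with
  | empty => rw [union_empty]
  | insert z S hzS ih =>
    have ih' := ih (fun w hw => hS w (mem_insert_of_mem hw))
    have e1 : Y ∪ insert z S = insert z (Y ∪ S) := by
      ext x; simp only [mem_union, mem_insert]; tauto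
    rw [e1, rk_insert_union_eq_of_rk_insert_eq' (hS z (mem_insert_self _ _)), ih']

/-- **THE CLOSURE OF AN ON SET THROUGH `e, f` IS AN ON FLAT THROUGH `e, f`.** -/
theorem on_plane_of_on_set (h : SeriesPair N b b') (hE7 : rk N (((gr N).erase b).erase b') = 4) {e f : α}
    {Y₀ : Finset α} (hY₀ : Y₀ ⊆ ((gr N).erase b).erase b') (heY₀ : e ∈ Y₀) (hfY₀ : f ∈ Y₀) (hY₀3 : rk N Y₀ = 3)
    (hY₀on : rk N (insert b (insert b' Y₀)) = 4) :
    ∃ H : Finset α, H ⊆ ((gr N).erase b).erase b' ∧ e ∈ H ∧ f ∈ H ∧ rk N H = 3 ∧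
      rk N (insert b (insert b' H)) = 4 ∧ ∀ z ∈ ((gr N).erase b).erase b', z ∉ H → rk N (insert z H) = 4 := by
  have _ := h
  refine ⟨(((gr N).erase b).erase b').filter (fun z => rk N (insert z Y₀) = 3), filter_subset _ _, ?_, ?_, ?_, ?_, ?_⟩
  · exact mem_filter.2 ⟨hY₀ heY₀, by rw [insert_eq_of_mem heY₀, hY₀3]⟩
  · exact mem_filter.2 ⟨hY₀ hfY₀, by rw [insert_eq_of_mem hfY₀, hY₀3]⟩
  · have hsub : Y₀ ⊆ (((gr N).erase b).erase b').filter (fun z => rk N (insert z Y₀) = 3) := fun z hz =>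
      mem_filter.2 ⟨hY₀ hz, by rw [insert_eq_of_mem hz, hY₀3]⟩
    rw [← union_eq_right.2 hsub, rk_union_eq_of_forall_insert_eq _ (fun z hz => by rw [(mem_filter.1 hz).2, hY₀3]),
      hY₀3]
  · have hsub : Y₀ ⊆ (((gr N).erase b).erase b').filter (fun z => rk N (insert z Y₀) = 3) := fun z hz =>
      mem_filter.2 ⟨hY₀ hz, by rw [insert_eq_of_mem hz, hY₀3]⟩
    have e1 : insert b (insert b' ((((gr N).erase b).erase b').filter (fun z => rk N (insert z Y₀) = 3))) =
        insert b (insert b' Y₀) ∪ (((gr N).erase b).erase b').filter (fun z => rk N (insert z Y₀) = 3) := by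
      ext x; simp only [mem_insert, mem_union]
      constructor
      · rintro (rfl | rfl | hx)
        · exact Or.inl (Or.inl rfl)
        · exact Or.inl (Or.inr (Or.inl rfl))
        · exact Or.inr hx
      · rintro ((rfl | rfl | hx) | hx)
        · exact Or.inl rfl
        · exact Or.inr (Or.inl rfl)
        · exact Or.inr (Or.inr (hsub hx))
        · exact Or.inr (Or.inr hx)
    rw [e1, rk_union_eq_of_forall_insert_eq _ (fun z hz => ?_), hY₀on]
    have hz3 : rk N (insert z Y₀) = rk N Y₀ := by rw [(mem_filter.1 hz).2, hY₀3]
    have e2 : insert b (insert b' Y₀) = Y₀ ∪ {b, b'} := by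
      ext x; simp only [mem_insert, mem_union, mem_singleton]; tauto
    rw [e2]
    exact rk_insert_union_eq_of_rk_insert_eq' hz3
  · intro z hzE hzH
    have hne : ¬ rk N (insert z Y₀) = 3 := fun h' => hzH (mem_filter.2 ⟨hzE, h'⟩)
    have h1 : rk N Y₀ ≤ rk N (insert z Y₀) := rk_mono' (M := N) (subset_insert _ _)
    have h2 : rk N (insert z Y₀) ≤ rk N (insert z ((((gr N).erase b).erase b').filter (fun w => rk N (insert w Y₀) = 3))) :=
      rk_mono' (M := N) (insert_subset_insert z (fun w hw => mem_filter.2 ⟨hY₀ hw, by rw [insert_eq_of_mem hw, hY₀3]⟩))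
    have h3 : rk N (insert z ((((gr N).erase b).erase b').filter (fun w => rk N (insert w Y₀) = 3))) ≤
        rk N (((gr N).erase b).erase b') := rk_mono' (M := N) (insert_subset hzE (filter_subset _ _))
    omega

/-- **THE NO-ON-LINE REGIME OF CASE D0 OF `StarNineSharp`.** -/
theorem inCount_thru_le_of_no_on_line (hn : (gr N).card = 9) (hR : rk N (gr N) = 5)
    (hcf : ∀ x ∈ gr N, rk N ((gr N).erase x) = 5) (h : SeriesPair N b b')
    {e f : α} (he : e ∈ gr N) (hf : f ∈ gr N) (hef : e ≠ f) (heb : e ≠ b) (heb' : e ≠ b') (hfb : f ≠ b) (hfb' : f ≠ b')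
    (hE7 : rk N (((gr N).erase b).erase b') = 4)
    (hnl : ∀ S : Finset α, S ⊆ ((gr N).erase b).erase b' → rk N (insert b (insert b' S)) ≤ 3 → rk N S ≤ 1)
    (he1 : ∀ y ∈ ((((gr N).erase b).erase b').erase f).erase e, rk N {e, y} = 2)
    (hf1 : ∀ y ∈ ((((gr N).erase b).erase b').erase f).erase e, rk N {f, y} = 2)
    (hef2 : rk N {e, f} = 2) (hX : rk N (((((gr N).erase b).erase b').erase f).erase e) = 4) :
    inCount N 4 e + thruCount N 4 {b', f} + thruCount N 4 {b', e, f} ≤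
      inCount N 4 f + thruCount N 4 {e, f} + thruCount N 4 {b', e} := by
  by_cases hex : ∃ Y : Finset α, Y ⊆ ((gr N).erase b).erase b' ∧ e ∈ Y ∧ f ∈ Y ∧ rk N Y = 3 ∧
      rk N (insert b (insert b' Y)) = 4
  · obtain ⟨Y₀, hY₀, heY₀, hfY₀, hY₀3, hY₀on⟩ := hex
    obtain ⟨H, hH, heH, hfH, hH3, hHon, hHfl⟩ := on_plane_of_on_set h hE7 hY₀ heY₀ hfY₀ hY₀3 hY₀on
    exact inCount_thru_le_of_no_on_line_with_H hn hR hcf h he hf hef heb heb' hfb hfb' hE7 hnl he1 hf1 hef2 hX hH heH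
      hfH hH3 hHon hHfl
  · apply inCount_thru_le_of_no_on_line_no_ef hn hR h he hf hef heb heb' hfb hfb' hnl he1 hX
    intro Y hY heY hfY hY3
    have hb := rk_insert_bb'_bounds h hY
    have hne : ¬ rk N (insert b (insert b' Y)) = 4 := fun h' => hex ⟨Y, hY, heY, hfY, hY3, h'⟩
    omega

end StarSharpD0J

end PercRepro.Cogirth
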